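import Mathlib.Analysis.SpecialFunctions.Pow.Real
import Literature.Computability.AlgebraicComplexity.HomogeneousCircuits
import Literature.Computability.AlgebraicComplexity.StandardFamilies
import HarnessLib

/-!
# OPEN STRENGTHENING of Kumar–Saraf 2017, Thm. 1.2 (`n^{Ω(√d)}` lower bounds for `IMM` against
homogeneous product-depth-2 circuits) — NOT a D-0014 named fact; the named fact proper is
`kumarSaraf2017_imm_homDepthFour` (`HomogeneousDepthFour.lean`)

Trunk T-CPLX-ALG; cite item `wi-03853` (route ValiantsHypothesis/Depth4: the barrier matching
Tavenas' upper bound — a measure proving stmt-0330 must exceed `n^{O(√d)}` on `per_n` but not on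
`IMM`), over the tree's `homProductDepthCircuitSize` (`HomogeneousCircuits.lean`) and `immPoly`
(`StandardFamilies.lean`).

**Kumar–Saraf 2017 (SIAM J. Comput. 46; arXiv:1404.1950), Thm. 1.2 / abstract.** Over EVERY
field, any homogeneous depth-4 (`ΣΠΣΠ`) circuit computing the `(1,1)` entry of the product of `n`
generic matrices of dimension `n^{O(1)}` has size `n^{Ω(√n)}`; equivalently (their §1) homogeneous
`ΣΠΣΠ` circuits for `IMM_{N,d}` need size `N^{Ω(√d)}` in the relevant regime — tight with Tavenas
2015. Earlier: FLMS 2015, Thm. 1 (bounded bottom fan-in), KLSS 2017, Thm. 1 (characteristic `0`).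

**AUDIT (provefact `DepthReductionChasm`, 2026-08-14): this rendering is STRONGER than print,
not weaker.** The measure `homProductDepthCircuitSize 2` (`HomogeneousCircuits.lean`) minimises
over homogeneous circuits of PRODUCT-DEPTH `≤ 2`, which may carry a layer of sum gates below the
bottom products (products of linear forms), i.e. over homogeneous `ΣΠΣΠΣ` = depth-5 circuits
(`ArithCircuit.exists_productDepth_two_not_isDepthFour`, `HomogeneousDepthFour.lean`), while
the source's `ΣΠΣΠ` circuits
have depth 4 with PRODUCT gates over leaves at the bottom (Kumar–Saraf 2017, §3, eq. (3.1);
the random restriction of Lemma 8.2 kills bottom MONOMIALS of large support). An `n^{ε√n}` lower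
bound for `IMM_{n^c,n}` against homogeneous depth-5 circuits is not known over any field
(finite fields: `exp(Ω_q(√d))` for an `NW`-type family [Kumar–Saptharishi 2017, Thm. 1];
characteristic `0`: `n^{Ω(√d)}/2^{O(d)}`, superpolynomial only for `d ≤ log² n`
[Amireddy–Garg–Kayal–Saha–Thankey 2023, Thm. 1.3, Open Problem 1.2]). The statement AS PRINTED
(Thm. 1.2 = Thm. 8.10; note that Thm. 1.1 of the paper is the `VNP`/Nisan–Wigderson theorem) is
the named fact `kumarSaraf2017_imm_homDepthFour` of `HomogeneousDepthFour.lean`, over the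
depth-4 measure `homDepthFourCircuitSize`; the present `Prop` implies it
(`kumar_saraf_imm_depth4.homDepthFour`) and asserts nothing by itself. The trace-versus-entry
remark below is correct and applies to both.

Rendering of the polynomial (weaker than print, hence safe). The tree's `immPoly N d k` is the TRACE
`tr(X⁽¹⁾ ⋯ X⁽ᵈ⁾)` of the product of `d` generic `N × N` matrices; the `(1,1)` entry
`(X⁽¹⁾ ⋯ X⁽ᵈ⁾)₁₁` is obtained from it by the zero-substitution `X⁽¹⁾_{ij} ↦ 0` for `i ≠ 1`
(then only the first row of the product survives and `tr = (·)₁₁`, which involves the first row of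
`X⁽¹⁾` only), and zero-substitutions preserve homogeneous `ΣΠΣΠ` circuits without increasing size;
so a lower bound for the `(1,1)` entry is a lower bound for the trace. We state the abstract's form:
for every field there are `c` and `ε > 0` with
`homProductDepthCircuitSize 2 (immPoly (n^c) n k) ≥ n^{ε √n}` for all large `n` (in `ℕ∞`, so
vacuous should no homogeneous circuit exist). Nothing asserted.

## References

* M. Kumar, S. Saraf, *On the power of homogeneous depth 4 arithmetic circuits*, SIAM J. Comput.
  46 (2017) 336–387, Thm. 1.2 (abstract), §3 (model), Lemma 8.2, Thm. 8.10.
* M. Kumar, R. Saptharishi, *An exponential lower bound for homogeneous depth-5 circuits over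
  finite fields*, CCC 2017, Thm. 1 (audit).
* P. Amireddy, A. Garg, N. Kayal, C. Saha, B. Thankey, *Low-depth arithmetic circuit lower
  bounds: bypassing set-multilinearization*, ICALP 2023, Thm. 1.3, Open Problem 1.2 (audit).
* N. Kayal, N. Limaye, C. Saha, S. Srinivasan, SIAM J. Comput. 46 (2017) 307–335, Thm. 1.
* H. Fournier, N. Limaye, G. Malod, S. Srinivasan, SIAM J. Comput. 44 (2015) 1173–1201, Thm. 1.
* S. Tavenas, Inform. and Comput. 240 (2015), Thm. 1 (the matching upper bound).
-/

noncomputable section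

namespace Literature.Computability.AlgebraicComplexity

/-- **OPEN STRENGTHENING of Kumar–Saraf 2017, Thm. 1.2 — NOT a D-0014 named fact and not
dischargeable; the named fact proper is `kumarSaraf2017_imm_homDepthFour`
(`HomogeneousDepthFour.lean`).** Statement: for every field `k` there are a dimension exponent
`c`, a constant `ε > 0` and `n₀` such that for all `n ≥ n₀` every HOMOGENEOUS circuit of
PRODUCT-DEPTH `≤ 2` — a class containing the printed depth-4 `ΣΠΣΠ` circuits but also
homogeneous depth-5 `ΣΠΣΠΣ` circuits — computing the iterated matrix multiplication polynomial
`immPoly (n^c) n k` (trace of the product of `n` generic `n^c × n^c` matrices) has at least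
`n^{ε√n}` gates. Print (Kumar–Saraf 2017, Thm. 1.2 = Thm. 8.10; KLSS 2017, Thm. 1 and FLMS 2015,
Thm. 1 for subclasses) proves this for depth-4 circuits only: that is
`kumarSaraf2017_imm_homDepthFour`, a CONSEQUENCE of the present `Prop`
(`kumar_saraf_imm_depth4.homDepthFour`); for the depth-5 part of the class the bound is an open
problem (module docstring AUDIT). A user taking `(h : kumar_saraf_imm_depth4)` assumes an open
conjecture-shaped statement, not a published theorem.
[cite: KumarSaraf2017, Thm. 1.2 (implied consequence, kumar_saraf_imm_depth4.homDepthFour)]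
[cite: AmireddyGargKayalSahaThankey2023, Open Problem 1.2] -/
def kumar_saraf_imm_depth4 : Prop :=
  ∀ (k : Type) [Field k], ∃ (c n₀ : ℕ) (ε : ℝ), 0 < ε ∧ ∀ n : ℕ, n₀ ≤ n →
    ((⌈(n : ℝ) ^ (ε * Real.sqrt n)⌉₊ : ℕ) : ℕ∞) ≤ homProductDepthCircuitSize 2 (immPoly (n ^ c) n k)

/-- Consequence shape: in the barrier regime no homogeneous product-depth-2 circuit for `IMM` of
size below `n^{ε√n}` exists (contrapositive reading of the size bound; conditional on the open
strengthening `h` — the printed analogue is `homDepthFourCircuitSize_imm_ge` of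
`HomogeneousDepthFour.lean`). [folklore] -/
theorem homProductDepthCircuitSize_imm_lt_irrefl (h : kumar_saraf_imm_depth4) (k : Type) [Field k] :
    ∃ (c n₀ : ℕ) (ε : ℝ), 0 < ε ∧ ∀ n : ℕ, n₀ ≤ n → ∀ s : ℕ,
      homProductDepthCircuitSize 2 (immPoly (n ^ c) n k) = s → ⌈(n : ℝ) ^ (ε * Real.sqrt n)⌉₊ ≤ s := by
  obtain ⟨c, n₀, ε, hε, hn⟩ := h k
  refine ⟨c, n₀, ε, hε, fun n hn' s hs => ?_⟩
  have := hn n hn'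
  rw [hs] at this
  exact_mod_cast this

end Literature.Computability.AlgebraicComplexity
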